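import Summits.CriticalPhenomena.PercolationContinuityZ3.Theorems.PercNearOneGluingNoHeavyLowerTailChampionStability
import HarnessLib

/-!
# `NoHeavyLowerTail` (stmt-CriticalPhenomena-4575) — two-port peeling: reachability through an isolated two-port hub

Route `PercNearOneGluingNoHeavy`, seat `prim-gen-swap` (gen 5); memo TWO-PORT-PEELING.md §6 (level-2 translation of the comonotone certificate).
If `u` has no open pair in `ω`, then opening the two port pairs `s(u,a)`, `s(u,a')` glues `a` and `a'` through `u` and changes nothing else:
* `TwoPortPeeling.reachable_pendant_iff` — one pendant pair at an isolated vertex does not change reachability among the other vertices;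
* `TwoPortPeeling.reachable_hub_iff` — for `x, z ≠ u`: `x ↔ z` in `ω ∪ {s(u,a), s(u,a')}` iff `x ↔ z`, or `x ↔ {a,a'}` and `{a,a'} ↔ z`, in `ω`;
* `TwoPortPeeling.reachable_hub_center_iff` — `x ↔ u` in `ω ∪ {s(u,a), s(u,a')}` iff `x ↔ a` or `x ↔ a'` in `ω`;
* `TwoPortPeeling.three_le_card_hub` — if `x ∉ {a,a'}` is joined to `a` or `a'`, its relay set after the gluing has at least three elements
  (so it is never "small" at level `j ≤ 2`);
* `TwoPortPeeling.filter_hub_eq_of_not` — if `x` is joined to neither `a` nor `a'`, its relay set is unchanged.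
No definitions, no named facts, no sorries.
-/

noncomputable section

namespace Summit.CriticalPhenomena.PercolationContinuityZ3.Theorems

open MeasureTheory Set Literature.Probability.LatticeModels Literature.Probability.Percolation
open scoped Classical BigOperators

variable {n : ℕ}

namespace TwoPortPeeling

open ChampionStability in
/-- A pendant pair at an isolated vertex: for `p, q ≠ u`, `p ↔ q` in `ω ∪ {s(u,a')}` iff `p ↔ q` in `ω`, provided `u` has no open pair in `ω`.
[folklore] -/
theorem reachable_pendant_iff (ω : BondConfig (Fin n)) {u a' : Fin n} (hua' : u ≠ a')
    (hiso : ∀ y : Fin n, y ≠ u → s(u, y) ∉ ω) {p q : Fin n} (hp : p ≠ u) (hq : q ≠ u) :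
    (openGraph (insert s(u, a') ω)).Reachable p q ↔ (openGraph ω).Reachable p q := by
  have hnu : ∀ y : Fin n, y ≠ u → ¬ (openGraph ω).Reachable u y := by
    intro y hyu ⟨wk⟩
    cases wk with
    | nil => exact hyu rfl
    | cons hadj _ =>
      rw [openGraph_adj] at hadj
      exact hiso _ (fun h => hadj.2 h.symm) hadj.1
  rw [reachable_insert_iff ω hua' p q]
  constructor
  · rintro (h | ⟨⟨s₁, hs₁, h₁⟩, ⟨s₂, hs₂, h₂⟩⟩)
    · exact h
    · simp only [Finset.mem_insert, Finset.mem_singleton] at hs₁ hs₂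
      rcases hs₁ with rfl | rfl
      · exact absurd h₁.symm (hnu p hp)
      · rcases hs₂ with rfl | rfl
        · exact absurd h₂ (hnu q hq)
        · exact h₁.trans h₂
  · exact fun h => Or.inl h

open ChampionStability in
/-- **Reachability through an isolated two-port hub.**  If `u` has no open pair in `ω`, `u ∉ {a, a'}`, then for `x, z ≠ u`:
`x ↔ z` in `ω ∪ {s(u,a), s(u,a')}` iff `x ↔ z` in `ω`, or (`x ↔ a` or `x ↔ a'`) and (`a ↔ z` or `a' ↔ z`) in `ω`. [folklore] -/
theorem reachable_hub_iff (ω : BondConfig (Fin n)) {u a a' : Fin n} (hua : u ≠ a) (hua' : u ≠ a')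
    (hiso : ∀ y : Fin n, y ≠ u → s(u, y) ∉ ω) {x z : Fin n} (hx : x ≠ u) (hz : z ≠ u) :
    (openGraph (insert s(u, a) (insert s(u, a') ω))).Reachable x z ↔
      ((openGraph ω).Reachable x z ∨
        (((openGraph ω).Reachable x a ∨ (openGraph ω).Reachable x a') ∧
          ((openGraph ω).Reachable a z ∨ (openGraph ω).Reachable a' z))) := by
  set ω₁ := insert s(u, a') ω with hω₁
  have hpq : ∀ {p q : Fin n}, p ≠ u → q ≠ u → ((openGraph ω₁).Reachable p q ↔ (openGraph ω).Reachable p q) :=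
    fun hp hq => reachable_pendant_iff ω hua' hiso hp hq
  -- reaching the hub itself in `ω₁` means reaching `a'`
  have hxu : ∀ {p : Fin n}, p ≠ u → ((openGraph ω₁).Reachable p u ↔ (openGraph ω).Reachable p a') := by
    intro p hp
    rw [hω₁, reachable_insert_to_left_iff ω hua' p]
    have hnu : ¬ (openGraph ω).Reachable p u := by
      intro ⟨wk⟩
      cases wk.reverse with
      | nil => exact hp rfl
      | cons hadj _ =>
        rw [openGraph_adj] at hadj
        exact hiso _ (fun h => hadj.2 h.symm) hadj.1
    constructor
    · rintro (h | h)
      · exact absurd h hnu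
      · exact h
    · exact fun h => Or.inr h
  rw [reachable_insert_iff ω₁ hua x z]
  constructor
  · rintro (h | ⟨⟨s₁, hs₁, h₁⟩, ⟨s₂, hs₂, h₂⟩⟩)
    · exact Or.inl ((hpq hx hz).1 h)
    · simp only [Finset.mem_insert, Finset.mem_singleton] at hs₁ hs₂
      right
      refine ⟨?_, ?_⟩
      · rcases hs₁ with rfl | rfl
        · exact Or.inr ((hxu hx).1 h₁)
        · exact Or.inl ((hpq hx hua.symm).1 h₁)
      · rcases hs₂ with rfl | rfl
        · exact Or.inr ((hxu hz).1 h₂.symm).symm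
        · exact Or.inl ((hpq hua.symm hz).1 h₂)
  · rintro (h | ⟨h₁, h₂⟩)
    · exact Or.inl ((hpq hx hz).2 h)
    · right
      refine ⟨?_, ?_⟩
      · rcases h₁ with h₁ | h₁
        · exact ⟨a, by simp, (hpq hx hua.symm).2 h₁⟩
        · exact ⟨u, by simp, (hxu hx).2 h₁⟩
      · rcases h₂ with h₂ | h₂
        · exact ⟨a, by simp, (hpq hua.symm hz).2 h₂⟩
        · exact ⟨u, by simp, ((hxu hz).2 h₂.symm).symm⟩

open ChampionStability in
/-- Reaching the hub: for `x ≠ u`, `x ↔ u` in `ω ∪ {s(u,a), s(u,a')}` iff `x ↔ a` or `x ↔ a'` in `ω` (hub isolated in `ω`). [folklore] -/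
theorem reachable_hub_center_iff (ω : BondConfig (Fin n)) {u a a' : Fin n} (hua : u ≠ a) (hua' : u ≠ a')
    (hiso : ∀ y : Fin n, y ≠ u → s(u, y) ∉ ω) {x : Fin n} (hx : x ≠ u) :
    (openGraph (insert s(u, a) (insert s(u, a') ω))).Reachable x u ↔
      ((openGraph ω).Reachable x a ∨ (openGraph ω).Reachable x a') := by
  set ω₁ := insert s(u, a') ω with hω₁
  rw [reachable_insert_to_left_iff ω₁ hua x]
  have h1 : (openGraph ω₁).Reachable x u ↔ (openGraph ω).Reachable x a' := by
    rw [hω₁, reachable_insert_to_left_iff ω hua' x]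
    have hnu : ¬ (openGraph ω).Reachable x u := by
      intro ⟨wk⟩
      cases wk.reverse with
      | nil => exact hx rfl
      | cons hadj _ =>
        rw [openGraph_adj] at hadj
        exact hiso _ (fun h => hadj.2 h.symm) hadj.1
    exact ⟨fun h => h.elim (fun h => absurd h hnu) id, fun h => Or.inr h⟩
  have h2 : (openGraph ω₁).Reachable x a ↔ (openGraph ω).Reachable x a :=
    reachable_pendant_iff ω hua' hiso hx hua.symm
  rw [h1, h2]
  exact Or.comm

/-- **Attached vertices are big after the gluing (level `≤ 2` bookkeeping).**  If `x ∉ {a, a'}` (all in `A`, `a ≠ a'`) is joined to `a` or to `a'`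
in `ω`, then after gluing `a, a'` through the isolated hub `u ∉ A` the relay set of `x` has at least three elements. [this file] -/
theorem three_le_card_hub (A : Finset (Fin n)) (ω : BondConfig (Fin n)) {u a a' x : Fin n} (hu : u ∉ A)
    (ha : a ∈ A) (ha' : a' ∈ A) (hx : x ∈ A) (haa' : a ≠ a') (hxa : x ≠ a) (hxa' : x ≠ a')
    (hiso : ∀ y : Fin n, y ≠ u → s(u, y) ∉ ω)
    (hatt : (openGraph ω).Reachable x a ∨ (openGraph ω).Reachable x a') :
    3 ≤ (A.filter fun z => insert s(u, a) (insert s(u, a') ω) ∈ openConn x z).card := by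
  have hua : u ≠ a := fun h => hu (h ▸ ha)
  have hua' : u ≠ a' := fun h => hu (h ▸ ha')
  have hxu : x ≠ u := fun h => hu (h ▸ hx)
  have hsub : ({x, a, a'} : Finset (Fin n)) ⊆ A.filter fun z => insert s(u, a) (insert s(u, a') ω) ∈ openConn x z := by
    intro z hz
    simp only [Finset.mem_insert, Finset.mem_singleton] at hz
    rw [Finset.mem_filter]
    rcases hz with rfl | rfl | rfl
    · exact ⟨hx, (SimpleGraph.Reachable.refl _ : (openGraph _).Reachable _ _)⟩
    · refine ⟨ha, (reachable_hub_iff ω hua hua' hiso hxu hua.symm).2 (Or.inr ⟨hatt, Or.inl (SimpleGraph.Reachable.refl _)⟩)⟩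
    · refine ⟨ha', (reachable_hub_iff ω hua hua' hiso hxu hua'.symm).2 (Or.inr ⟨hatt, Or.inr (SimpleGraph.Reachable.refl _)⟩)⟩
  have hcard : ({x, a, a'} : Finset (Fin n)).card = 3 := by
    rw [Finset.card_eq_three]
    exact ⟨x, a, a', hxa, hxa', haa', rfl⟩
  exact hcard ▸ Finset.card_le_card hsub

/-- **Unattached vertices keep their relay set.**  If `x ≠ u` is joined to neither `a` nor `a'` in `ω` (hub `u ∉ A` isolated), its relay set is
unchanged by the gluing. [this file] -/
theorem filter_hub_eq_of_not (A : Finset (Fin n)) (ω : BondConfig (Fin n)) {u a a' x : Fin n} (hu : u ∉ A)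
    (hua : u ≠ a) (hua' : u ≠ a') (hxu : x ≠ u) (hiso : ∀ y : Fin n, y ≠ u → s(u, y) ∉ ω)
    (hxa : ¬ (openGraph ω).Reachable x a) (hxa' : ¬ (openGraph ω).Reachable x a') :
    (A.filter fun z => insert s(u, a) (insert s(u, a') ω) ∈ openConn x z) = (A.filter fun z => ω ∈ openConn x z) := by
  refine Finset.filter_congr fun z hz => ?_
  have hzu : z ≠ u := fun h => hu (h ▸ hz)
  rw [show (insert s(u, a) (insert s(u, a') ω) ∈ openConn x z) =
      (openGraph (insert s(u, a) (insert s(u, a') ω))).Reachable x z from rfl, reachable_hub_iff ω hua hua' hiso hxu hzu]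
  constructor
  · rintro (h | ⟨h1, -⟩)
    · exact h
    · exact absurd h1 (not_or.2 ⟨hxa, hxa'⟩)
  · exact fun h => Or.inl h

/-- **The glued relay's set.**  After gluing `a, a'` through the isolated hub `u ∉ A`, the relay set of `a` is `π(a) ∪ π(a')`. [this file] -/
theorem filter_hub_self (A : Finset (Fin n)) (ω : BondConfig (Fin n)) {u a a' : Fin n} (hu : u ∉ A)
    (ha : a ∈ A) (hua' : u ≠ a') (hiso : ∀ y : Fin n, y ≠ u → s(u, y) ∉ ω) :
    (A.filter fun z => insert s(u, a) (insert s(u, a') ω) ∈ openConn a z) =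
      (A.filter fun z => ω ∈ openConn a z) ∪ (A.filter fun z => ω ∈ openConn a' z) := by
  have hua : u ≠ a := fun h => hu (h ▸ ha)
  ext z
  rw [Finset.mem_union, Finset.mem_filter, Finset.mem_filter, Finset.mem_filter]
  constructor
  · rintro ⟨hz, h⟩
    have hzu : z ≠ u := fun h' => hu (h' ▸ hz)
    rcases (reachable_hub_iff ω hua hua' hiso hua.symm hzu).1 h with h | ⟨-, h | h⟩
    · exact Or.inl ⟨hz, h⟩
    · exact Or.inl ⟨hz, h⟩
    · exact Or.inr ⟨hz, h⟩
  · rintro (⟨hz, h⟩ | ⟨hz, h⟩)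
    · have hzu : z ≠ u := fun h' => hu (h' ▸ hz)
      exact ⟨hz, (reachable_hub_iff ω hua hua' hiso hua.symm hzu).2 (Or.inl h)⟩
    · have hzu : z ≠ u := fun h' => hu (h' ▸ hz)
      exact ⟨hz, (reachable_hub_iff ω hua hua' hiso hua.symm hzu).2
        (Or.inr ⟨Or.inl (SimpleGraph.Reachable.refl _), Or.inr h⟩)⟩

end TwoPortPeeling

end Summit.CriticalPhenomena.PercolationContinuityZ3.Theorems

end
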